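import Summits.Ventures.PercRepro.S1JointPerFlat

/-!
# PercRepro — S1 JOINT PAIR BUDGET, THE PAIRS AVOID THEIR CIRCUIT (LEMMA J′; p2, gen 15; SUBCLAIM-S1 §4 (A8))

A pair `(C, B')` of `pairsOf M F` has `B' ⊆ F ∖ C ⊆ E ∖ C`, so the pairs with a `k`-circuit number at most
`s_k · C(n − k, 5 − k)` — not `s_k · C(n, 5 − k)` as in `S1PerFlatCount` / `S1JointPerFlat`; for the big flats
`C ⊆ F ⊆ S₀` and `B' ⊆ S₀ ∖ C`, so at most `s_k · C(min(5d, n) − k, 5 − k)`. With the joint budget (`joint_arith`):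

* **`ncard_rank4_Icc_le_joint'`** — `7560·#{B : r(B) = 4, 5 ≤ |B| ≤ c} ≤ RS c·Π′_all + (RB c − RS c)·Π′_{S₀}`,
  `Π′_all = s₃·C(n − 3, 2) + s₄·(n − 4) + s₅`, `Π′_{S₀} = s₃·C(m − 3, 2) + s₄·(m − 4) + s₅`, `m = min(5d, n)`;
* **`ncard_eRk_eq_four_ncard_le_le_joint'`** — Proposition A in this form (`+ 7560·C(n, 4)`).
Axioms: standard.
-/

open scoped Matroid

namespace PercRepro

namespace S1

open Set

variable {α : Type}

/-- `Σ_{k=3}^{5} s_k · C(m − k, 5 − k) = s₃·C(m − 3, 2) + s₄·(m − 4) + s₅`. -/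
theorem sum_Icc_three_five' (s : ℕ → ℕ) (m : ℕ) :
    ∑ k ∈ Finset.Icc 3 5, s k * (m - k).choose (5 - k) = s 3 * (m - 3).choose 2 + s 4 * (m - 4) + s 5 := by
  rw [show Finset.Icc 3 5 = {3, 4, 5} by decide]
  rw [Finset.sum_insert (by decide), Finset.sum_insert (by decide), Finset.sum_singleton]
  simp only [Nat.choose_one_right, Nat.choose_zero_right, mul_one, show (5 : ℕ) - 3 = 2 from rfl,
    show (5 : ℕ) - 4 = 1 from rfl, show (5 : ℕ) - 5 = 0 from rfl]
  ring

/-- **THE RANK-`4` SETS WITH `5 ≤ |B| ≤ c`, PAIRS AVOIDING THEIR CIRCUIT, CHARGED ONCE.** -/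
theorem ncard_rank4_Icc_le_joint' (M : Matroid α) [M.Finite]
    (hcirc : ∀ C, M.IsCircuit C → 3 ≤ C.encard)
    (hline : ∀ L ⊆ M.E, M.eRk L ≤ 2 → L.ncard ≤ 3) (hplane : ∀ P ⊆ M.E, M.eRk P ≤ 3 → P.ncard ≤ 6)
    (hten : ∀ X ⊆ M.E, M.eRk X ≤ 4 → X.ncard ≤ 10) {d : ℕ} (hd : M.E.encard = M.eRank + d) (c : ℕ) :
    7560 * {B : Set α | B ⊆ M.E ∧ M.eRk B = 4 ∧ 5 ≤ B.ncard ∧ B.ncard ≤ c}.ncard ≤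
      RS c * ({C : Set α | M.IsCircuit C ∧ C.ncard = 3}.ncard * (M.E.ncard - 3).choose 2 +
        {C : Set α | M.IsCircuit C ∧ C.ncard = 4}.ncard * (M.E.ncard - 4) +
        {C : Set α | M.IsCircuit C ∧ C.ncard = 5}.ncard) +
      (RB c - RS c) * ({C : Set α | M.IsCircuit C ∧ C.ncard = 3}.ncard * (min (5 * d) M.E.ncard - 3).choose 2 +
        {C : Set α | M.IsCircuit C ∧ C.ncard = 4}.ncard * (min (5 * d) M.E.ncard - 4) +
        {C : Set α | M.IsCircuit C ∧ C.ncard = 5}.ncard) := by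
  classical
  -- the union of the short circuits
  set S₀ := ⋃₀ Matroid.circuitsLE M 5 with hS₀
  have hS₀E : S₀ ⊆ M.E := by
    intro x hx
    obtain ⟨C, hC, hxC⟩ := mem_sUnion.1 hx
    exact Matroid.subset_ground_of_mem_circuitsLE hC hxC
  have hS₀fin : S₀.Finite := M.ground_finite.subset hS₀E
  have hS₀card : S₀.ncard ≤ min (5 * d) M.E.ncard := by
    refine le_min ?_ (Set.ncard_le_ncard hS₀E M.ground_finite)
    have h := Matroid.encard_sUnion_circuitsLE_le (M := M) (k := 5) (d := d) hd
    rw [← hS₀fin.cast_ncard_eq] at h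
    exact_mod_cast h
  -- the sets to count, as a finset
  set S := {B : Set α | B ⊆ M.E ∧ M.eRk B = 4 ∧ 5 ≤ B.ncard ∧ B.ncard ≤ c} with hS
  have hSfin : S.Finite := M.ground_finite.finite_subsets.subset (fun B hB => hB.1)
  set Sf := hSfin.toFinset with hSf
  have hmemS : ∀ B, B ∈ Sf ↔ B ⊆ M.E ∧ M.eRk B = 4 ∧ 5 ≤ B.ncard ∧ B.ncard ≤ c := by
    intro B; rw [hSf, Set.Finite.mem_toFinset]; rfl
  -- the flats: the closures of the members of `S`
  set FL := Sf.image M.closure with hFL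
  have hflat : ∀ F ∈ FL, F ⊆ M.E ∧ M.closure F = F ∧ M.eRk F = 4 ∧ 5 ≤ F.ncard ∧ F.ncard ≤ 10 := by
    intro F hF
    rw [hFL, Finset.mem_image] at hF
    obtain ⟨B, hB, rfl⟩ := hF
    obtain ⟨hBE, hrB, h5, -⟩ := (hmemS B).1 hB
    have hclE : M.closure B ⊆ M.E := M.closure_subset_ground B
    have hrcl : M.eRk (M.closure B) = 4 := by rw [M.eRk_closure_eq]; exact hrB
    refine ⟨hclE, M.closure_closure B, hrcl, ?_, hten _ hclE hrcl.le⟩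
    exact h5.trans (Set.ncard_le_ncard (M.subset_closure B hBE) (M.ground_finite.subset hclE))
  -- per flat at most `β_c(|F|)` members
  have hfib : ∀ F ∈ FL, (Sf.filter (fun B => M.closure B = F)).card ≤ beta F.ncard c := by
    intro F hF
    obtain ⟨hFE, -, -, -, -⟩ := hflat F hF
    have hFfin : F.Finite := M.ground_finite.subset hFE
    rw [← Set.ncard_coe_finset]
    refine (Set.ncard_le_ncard ?_ (hFfin.finite_subsets.subset (fun B hB => hB.1))).trans
      (ncard_subsets_Icc_le hFfin c)
    intro B hB
    rw [Finset.mem_coe, Finset.mem_filter, hmemS] at hB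
    obtain ⟨⟨hBE, -, h5, hc⟩, hclB⟩ := hB
    refine ⟨?_, h5, hc⟩
    rw [← hclB]; exact M.subset_closure B hBE
  have hScount : Sf.card ≤ ∑ F ∈ FL, beta F.ncard c := by
    rw [Finset.card_eq_sum_card_fiberwise (f := M.closure) (t := FL)
      (fun B hB => Finset.mem_image_of_mem _ hB)]
    exact Finset.sum_le_sum hfib
  -- the pairs of a flat, as a finset
  set AP : Finset (Set α × Set α) :=
    (M.ground_finite.finite_subsets.prod M.ground_finite.finite_subsets).toFinset with hAP
  set PF : Set α → Finset (Set α × Set α) := fun F => AP.filter (fun x => x ∈ pairsOf M F) with hPF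
  have hmemPF : ∀ F ∈ FL, ∀ x, x ∈ PF F ↔ x ∈ pairsOf M F := by
    intro F hF x
    rw [hPF]
    simp only [Finset.mem_filter]
    constructor
    · exact fun h => h.2
    · intro hx
      refine ⟨?_, hx⟩
      rw [hAP, Set.Finite.mem_toFinset, Set.mem_prod]
      exact ⟨(pairsOf_subset hx).1.trans (hflat F hF).1, (pairsOf_subset hx).2.trans (hflat F hF).1⟩
  have hPFcard : ∀ F ∈ FL, (PF F).card = (pairsOf M F).ncard := by
    intro F hF
    rw [← Set.ncard_coe_finset]
    congr 1
    ext x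
    rw [Finset.mem_coe, hmemPF F hF]
  -- the pair sets of distinct flats are disjoint (a pair determines its flat)
  have hdisjPF : (FL : Set (Set α)).PairwiseDisjoint PF := by
    intro F hF F' hF' hne
    rw [Function.onFun, Finset.disjoint_left]
    intro x hx hx'
    rw [hmemPF F hF] at hx
    rw [hmemPF F' hF'] at hx'
    exact hne (by rw [← hx.2.2.2.2, ← hx'.2.2.2.2])
  -- the small and the big flats
  set FLs := FL.filter (fun F => F.ncard ≤ 7) with hFLs
  set FLb := FL.filter (fun F => ¬ F.ncard ≤ 7) with hFLb
  have hsplit : ∑ F ∈ FL, 7560 * beta F.ncard c =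
      ∑ F ∈ FLs, 7560 * beta F.ncard c + ∑ F ∈ FLb, 7560 * beta F.ncard c := by
    rw [hFLs, hFLb]
    exact (Finset.sum_filter_add_sum_filter_not FL _ _).symm
  have hsplitP : ∑ F ∈ FL, (PF F).card = ∑ F ∈ FLs, (PF F).card + ∑ F ∈ FLb, (PF F).card := by
    rw [hFLs, hFLb]
    exact (Finset.sum_filter_add_sum_filter_not FL _ _).symm
  have hws : ∑ F ∈ FLs, 7560 * beta F.ncard c ≤ RS c * ∑ F ∈ FLs, (PF F).card := by
    rw [Finset.mul_sum]
    apply Finset.sum_le_sum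
    intro F hF
    rw [hFLs, Finset.mem_filter] at hF
    obtain ⟨hFE, hcl, hr, h5, -⟩ := hflat F hF.1
    rw [hPFcard F hF.1]
    exact weight_small M hline hplane hFE hcl hr h5 hF.2 c
  have hwb : ∑ F ∈ FLb, 7560 * beta F.ncard c ≤ RB c * ∑ F ∈ FLb, (PF F).card := by
    rw [Finset.mul_sum]
    apply Finset.sum_le_sum
    intro F hF
    rw [hFLb, Finset.mem_filter] at hF
    obtain ⟨hFE, hcl, hr, -, h10⟩ := hflat F hF.1
    rw [hPFcard F hF.1]
    exact weight_big M hline hplane hFE hcl hr (by omega) h10 c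
  -- the circuits of each size; the subsets of `E ∖ C` and of `S₀ ∖ C` of each size
  have hcircfin : ∀ k : ℕ, {C : Set α | M.IsCircuit C ∧ C.ncard = k}.Finite := fun k =>
    M.ground_finite.finite_subsets.subset (fun C hC => hC.1.subset_ground)
  set 𝒞 : ℕ → Finset (Set α) := fun k => (hcircfin k).toFinset with h𝒞
  set 𝒞S : ℕ → Finset (Set α) := fun k => (𝒞 k).filter (fun C => C ⊆ S₀) with h𝒞S
  set 𝓑C : Set α → ℕ → Finset (Set α) := fun C j =>
    ((M.ground_finite.sdiff (t := C)).toFinset.powersetCard j).image (fun s : Finset α => (s : Set α)) with h𝓑C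
  set 𝓑S : Set α → ℕ → Finset (Set α) := fun C j =>
    ((hS₀fin.sdiff (t := C)).toFinset.powersetCard j).image (fun s : Finset α => (s : Set α)) with h𝓑S
  have h𝒞card : ∀ k, (𝒞 k).card = {C : Set α | M.IsCircuit C ∧ C.ncard = k}.ncard := fun k =>
    (Set.ncard_eq_toFinset_card _ (hcircfin k)).symm
  have h𝒞Scard : ∀ k, (𝒞S k).card ≤ {C : Set α | M.IsCircuit C ∧ C.ncard = k}.ncard := fun k => by
    rw [← h𝒞card k]; exact Finset.card_filter_le _ _
  have h𝓑Ccard : ∀ k, ∀ C ∈ 𝒞 k, (𝓑C C (5 - k)).card = (M.E.ncard - k).choose (5 - k) := by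
    intro k C hC
    rw [h𝒞, Set.Finite.mem_toFinset] at hC
    rw [h𝓑C]
    simp only
    rw [card_image_powersetCard (M.ground_finite.sdiff (t := C)) (5 - k),
      Set.ncard_sdiff' hC.1.subset_ground M.ground_finite, hC.2]
  have h𝓑Scard : ∀ k, ∀ C ∈ 𝒞S k, (𝓑S C (5 - k)).card ≤ (min (5 * d) M.E.ncard - k).choose (5 - k) := by
    intro k C hC
    rw [h𝒞S, Finset.mem_filter, h𝒞, Set.Finite.mem_toFinset] at hC
    rw [h𝓑S]
    simp only
    rw [card_image_powersetCard (hS₀fin.sdiff (t := C)) (5 - k), Set.ncard_sdiff' hC.2 hS₀fin, hC.1.2]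
    exact Nat.choose_le_choose _ (by omega)
  -- the data of a pair
  have hpair : ∀ F ∈ FL, ∀ x ∈ pairsOf M F, x.1 ∈ 𝒞 x.1.ncard ∧ x.1.ncard ∈ Finset.Icc 3 5 ∧
      x.2 ⊆ M.E \ x.1 ∧ x.2.ncard = 5 - x.1.ncard := by
    intro F hF x hx
    have hC := hx.1
    have hCfin : x.1.Finite := M.ground_finite.subset hC.subset_ground
    have h3 : 3 ≤ x.1.ncard := by
      have := hcirc _ hC
      rw [← hCfin.cast_ncard_eq] at this
      exact_mod_cast this
    refine ⟨?_, ?_, ?_, ?_⟩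
    · rw [h𝒞, Set.Finite.mem_toFinset]; exact ⟨hC, rfl⟩
    · rw [Finset.mem_Icc]; have := hx.2.2.2.1; omega
    · exact hx.2.2.1.trans (Set.sdiff_subset_sdiff_left (hflat F hF).1)
    · have := hx.2.2.2.1; omega
  -- all pairs of ALL flats lie in `⋃_k ⋃_{C ∈ 𝒞 k} {C} × 𝓑C C (5 − k)`
  have hsub_all : FL.biUnion PF ⊆
      (Finset.Icc 3 5).biUnion (fun k => (𝒞 k).biUnion (fun C => ({C} : Finset (Set α)) ×ˢ 𝓑C C (5 - k))) := by
    intro x hx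
    rw [Finset.mem_biUnion] at hx
    obtain ⟨F, hF, hxF⟩ := hx
    rw [hmemPF F hF] at hxF
    obtain ⟨h1, hk, h2E, h2c⟩ := hpair F hF x hxF
    rw [Finset.mem_biUnion]
    refine ⟨x.1.ncard, hk, ?_⟩
    rw [Finset.mem_biUnion]
    refine ⟨x.1, h1, ?_⟩
    rw [Finset.mem_product, Finset.mem_singleton]
    exact ⟨rfl, (mem_image_powersetCard_iff (M.ground_finite.sdiff (t := x.1)) _ x.2).2 ⟨h2E, h2c⟩⟩
  -- all pairs of the big flats lie in `⋃_k ⋃_{C ∈ 𝒞S k} {C} × 𝓑S C (5 − k)`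
  have hsub_big : FLb.biUnion PF ⊆
      (Finset.Icc 3 5).biUnion (fun k => (𝒞S k).biUnion (fun C => ({C} : Finset (Set α)) ×ˢ 𝓑S C (5 - k))) := by
    intro x hx
    rw [Finset.mem_biUnion] at hx
    obtain ⟨F, hF, hxF⟩ := hx
    rw [hFLb, Finset.mem_filter] at hF
    obtain ⟨hF', h8⟩ := hF
    rw [hmemPF F hF'] at hxF
    obtain ⟨h1, hk, -, h2c⟩ := hpair F hF' x hxF
    obtain ⟨hFE, -, hr, -, -⟩ := hflat F hF'
    have hS0 := pairsOf_subset_S0_of_eight_le M hplane hFE hr (by omega) x hxF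
    rw [Finset.mem_biUnion]
    refine ⟨x.1.ncard, hk, ?_⟩
    rw [Finset.mem_biUnion]
    refine ⟨x.1, ?_, ?_⟩
    · rw [h𝒞S, Finset.mem_filter]
      exact ⟨h1, subset_union_left.trans hS0⟩
    · rw [Finset.mem_product, Finset.mem_singleton]
      refine ⟨rfl, (mem_image_powersetCard_iff (hS₀fin.sdiff (t := x.1)) _ x.2).2 ⟨?_, h2c⟩⟩
      exact Set.subset_sdiff.2 ⟨subset_union_right.trans hS0, (Set.subset_sdiff.1 hxF.2.2.1).2⟩
  have hdisjb : (FLb : Set (Set α)).PairwiseDisjoint PF :=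
    hdisjPF.subset (by rw [hFLb]; exact Finset.coe_subset.2 (Finset.filter_subset _ _))
  have hPall : ∑ F ∈ FL, (PF F).card ≤
      {C : Set α | M.IsCircuit C ∧ C.ncard = 3}.ncard * (M.E.ncard - 3).choose 2 +
        {C : Set α | M.IsCircuit C ∧ C.ncard = 4}.ncard * (M.E.ncard - 4) +
        {C : Set α | M.IsCircuit C ∧ C.ncard = 5}.ncard := by
    rw [← sum_Icc_three_five' (fun k => {C : Set α | M.IsCircuit C ∧ C.ncard = k}.ncard) M.E.ncard]
    calc ∑ F ∈ FL, (PF F).card = (FL.biUnion PF).card := (Finset.card_biUnion hdisjPF).symm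
      _ ≤ ((Finset.Icc 3 5).biUnion
          (fun k => (𝒞 k).biUnion (fun C => ({C} : Finset (Set α)) ×ˢ 𝓑C C (5 - k)))).card :=
          Finset.card_le_card hsub_all
      _ ≤ ∑ k ∈ Finset.Icc 3 5, ((𝒞 k).biUnion (fun C => ({C} : Finset (Set α)) ×ˢ 𝓑C C (5 - k))).card :=
          Finset.card_biUnion_le
      _ ≤ ∑ k ∈ Finset.Icc 3 5, ∑ C ∈ 𝒞 k, (({C} : Finset (Set α)) ×ˢ 𝓑C C (5 - k)).card :=
          Finset.sum_le_sum (fun k _ => Finset.card_biUnion_le)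
      _ = ∑ k ∈ Finset.Icc 3 5, {C : Set α | M.IsCircuit C ∧ C.ncard = k}.ncard * (M.E.ncard - k).choose (5 - k) := by
          apply Finset.sum_congr rfl
          intro k _
          rw [← h𝒞card k, Finset.card_eq_sum_ones (𝒞 k), Finset.sum_mul]
          apply Finset.sum_congr rfl
          intro C hC
          rw [Finset.card_product, Finset.card_singleton, h𝓑Ccard k C hC, one_mul]
  have hPS0 : ∑ F ∈ FLb, (PF F).card ≤
      {C : Set α | M.IsCircuit C ∧ C.ncard = 3}.ncard * (min (5 * d) M.E.ncard - 3).choose 2 +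
        {C : Set α | M.IsCircuit C ∧ C.ncard = 4}.ncard * (min (5 * d) M.E.ncard - 4) +
        {C : Set α | M.IsCircuit C ∧ C.ncard = 5}.ncard := by
    rw [← sum_Icc_three_five' (fun k => {C : Set α | M.IsCircuit C ∧ C.ncard = k}.ncard) (min (5 * d) M.E.ncard)]
    calc ∑ F ∈ FLb, (PF F).card = (FLb.biUnion PF).card := (Finset.card_biUnion hdisjb).symm
      _ ≤ ((Finset.Icc 3 5).biUnion
          (fun k => (𝒞S k).biUnion (fun C => ({C} : Finset (Set α)) ×ˢ 𝓑S C (5 - k)))).card :=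
          Finset.card_le_card hsub_big
      _ ≤ ∑ k ∈ Finset.Icc 3 5, ((𝒞S k).biUnion (fun C => ({C} : Finset (Set α)) ×ˢ 𝓑S C (5 - k))).card :=
          Finset.card_biUnion_le
      _ ≤ ∑ k ∈ Finset.Icc 3 5, ∑ C ∈ 𝒞S k, (({C} : Finset (Set α)) ×ˢ 𝓑S C (5 - k)).card :=
          Finset.sum_le_sum (fun k _ => Finset.card_biUnion_le)
      _ ≤ ∑ k ∈ Finset.Icc 3 5, ∑ _C ∈ 𝒞S k, (min (5 * d) M.E.ncard - k).choose (5 - k) := by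
          apply Finset.sum_le_sum
          intro k _
          apply Finset.sum_le_sum
          intro C hC
          rw [Finset.card_product, Finset.card_singleton, one_mul]
          exact h𝓑Scard k C hC
      _ ≤ ∑ k ∈ Finset.Icc 3 5,
          {C : Set α | M.IsCircuit C ∧ C.ncard = k}.ncard * (min (5 * d) M.E.ncard - k).choose (5 - k) := by
          apply Finset.sum_le_sum
          intro k _
          rw [Finset.sum_const, smul_eq_mul]
          exact Nat.mul_le_mul_right _ (h𝒞Scard k)
  -- assemble: the joint budget
  have hSncard : S.ncard = Sf.card := Set.ncard_eq_toFinset_card _ hSfin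
  have hAX : ∑ F ∈ FLs, (PF F).card + ∑ F ∈ FLb, (PF F).card ≤
      {C : Set α | M.IsCircuit C ∧ C.ncard = 3}.ncard * (M.E.ncard - 3).choose 2 +
        {C : Set α | M.IsCircuit C ∧ C.ncard = 4}.ncard * (M.E.ncard - 4) +
        {C : Set α | M.IsCircuit C ∧ C.ncard = 5}.ncard := by
    rw [← hsplitP]; exact hPall
  have hjoint := joint_arith (RS := RS c) (RB := RB c) hAX hPS0
  calc 7560 * S.ncard = 7560 * Sf.card := by rw [hSncard]
    _ ≤ 7560 * ∑ F ∈ FL, beta F.ncard c := Nat.mul_le_mul_left _ hScount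
    _ = ∑ F ∈ FL, 7560 * beta F.ncard c := Finset.mul_sum _ _ _
    _ = ∑ F ∈ FLs, 7560 * beta F.ncard c + ∑ F ∈ FLb, 7560 * beta F.ncard c := hsplit
    _ ≤ RS c * ∑ F ∈ FLs, (PF F).card + RB c * ∑ F ∈ FLb, (PF F).card := add_le_add hws hwb
    _ ≤ _ := hjoint

/-- **PROPOSITION A, JOINT FORM WITH THE PAIRS AVOIDING THEIR CIRCUIT**: `7560·#{B ⊆ E : r(B) = 4, |B| ≤ d} ≤
7560·C(n, 4) + RS d·Π′_all + (RB d − RS d)·Π′_{S₀}`. -/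
theorem ncard_eRk_eq_four_ncard_le_le_joint' (M : Matroid α) [M.Finite]
    (hcirc : ∀ C, M.IsCircuit C → 3 ≤ C.encard)
    (hline : ∀ L ⊆ M.E, M.eRk L ≤ 2 → L.ncard ≤ 3) (hplane : ∀ P ⊆ M.E, M.eRk P ≤ 3 → P.ncard ≤ 6)
    (hten : ∀ X ⊆ M.E, M.eRk X ≤ 4 → X.ncard ≤ 10) {d : ℕ} (hd : M.E.encard = M.eRank + d) :
    7560 * {B : Set α | B ⊆ M.E ∧ M.eRk B = 4 ∧ B.ncard ≤ d}.ncard ≤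
      7560 * M.E.ncard.choose 4 +
      RS d * ({C : Set α | M.IsCircuit C ∧ C.ncard = 3}.ncard * (M.E.ncard - 3).choose 2 +
        {C : Set α | M.IsCircuit C ∧ C.ncard = 4}.ncard * (M.E.ncard - 4) +
        {C : Set α | M.IsCircuit C ∧ C.ncard = 5}.ncard) +
      (RB d - RS d) * ({C : Set α | M.IsCircuit C ∧ C.ncard = 3}.ncard * (min (5 * d) M.E.ncard - 3).choose 2 +
        {C : Set α | M.IsCircuit C ∧ C.ncard = 4}.ncard * (min (5 * d) M.E.ncard - 4) +
        {C : Set α | M.IsCircuit C ∧ C.ncard = 5}.ncard) := by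
  classical
  have hcore := ncard_rank4_Icc_le_joint' M hcirc hline hplane hten hd d
  set Ef := M.ground_finite.toFinset with hEf
  have hE : (Ef : Set α) = M.E := Set.Finite.coe_toFinset _
  have hEcard : Ef.card = M.E.ncard := (Set.ncard_eq_toFinset_card _ M.ground_finite).symm
  set S₁ := {B : Set α | B ⊆ (Ef : Set α) ∧ B.ncard = 4} with hS₁
  set S₂ := {B : Set α | B ⊆ M.E ∧ M.eRk B = 4 ∧ 5 ≤ B.ncard ∧ B.ncard ≤ d} with hS₂
  have hsplit : {B : Set α | B ⊆ M.E ∧ M.eRk B = 4 ∧ B.ncard ≤ d} ⊆ S₁ ∪ S₂ := by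
    intro B hB
    have hBfin : B.Finite := M.ground_finite.subset hB.1
    have hle : 4 ≤ B.ncard := by
      have := M.eRk_le_encard B
      rw [hB.2.1, ← hBfin.cast_ncard_eq] at this
      exact_mod_cast this
    rcases hle.lt_or_eq with h | h
    · exact Or.inr ⟨hB.1, hB.2.1, h, hB.2.2⟩
    · exact Or.inl ⟨by rw [hE]; exact hB.1, h.symm⟩
  have hS₁fin : S₁.Finite := (Ef.finite_toSet.finite_subsets).subset (fun B hB => hB.1)
  have hS₂fin : S₂.Finite := M.ground_finite.finite_subsets.subset (fun B hB => hB.1)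
  have hS₁card : S₁.ncard = M.E.ncard.choose 4 := by
    rw [hS₁, PercRepro.ncard_subsets_ncard_eq Ef 4, hEcard]
  calc 7560 * {B : Set α | B ⊆ M.E ∧ M.eRk B = 4 ∧ B.ncard ≤ d}.ncard
      ≤ 7560 * (S₁ ∪ S₂).ncard :=
        Nat.mul_le_mul_left _ (Set.ncard_le_ncard hsplit (hS₁fin.union hS₂fin))
    _ ≤ 7560 * (S₁.ncard + S₂.ncard) := Nat.mul_le_mul_left _ (Set.ncard_union_le _ _)
    _ = 7560 * M.E.ncard.choose 4 + 7560 * S₂.ncard := by rw [hS₁card]; ring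
    _ ≤ _ := by
        have := hcore
        omega

end S1

end PercRepro
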